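import Literature.NumberTheory.EllipticCurves.NewformsMainLemmaProofs
import Literature.NumberTheory.EllipticCurves.NewformsLevelRaising
import Literature.NumberTheory.QuadraticFields.JacobiCharacterPrimitiveProofs
import Literature.NumberTheory.EllipticCurves.ModularCurveIharaLemma
import Literature.NumberTheory.EllipticCurves.NewformsHeckeProofs
import Literature.NumberTheory.EllipticCurves.Gamma1PeriodLatticeTwistProofs
import HarnessLib
/-!
# L-TWIST, core: the DOUBLE TWIST identity on `Γ₀(N q²)` and `Λ(f) ⊆ τ(χ)·Λ(f ⊗ χ) + p·Λ(f)` from a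
# `(x, 0, 0)`-lift of cycles (route `EdixhovenFibreFiveSeven`, crux TDS57 / KP57, `--supports`)

Cell `pub/bsd-wall` (D-0145 line `route-BirchSwinnertonDyer-EdixhovenFibreFiveSeven`), seat `bsd-line-edix-p2`
(prover). Route-free file: THEOREMS ONLY (no definition, no named fact, no `sorry`). BSD is not proved by this file.

The input (L-TWIST) `hLT` of the landed conditional theorems
`TwistDegreeStepFiveSevenKPTors.twistDegreeStepFiveSeven_of_kato_of_periodTwist : F″ → L-TWIST → TDS57`
(p589348) and `TwistDegreeStepFiveSevenUnitTwist.exists_datum_not_dvd_c_of_kato_of_unitTwist` is the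
twisted-period decomposition `Λ(f) ⊆ s·Λ(f ⊗ χ_q) + p·Λ(f)` (`s² = q*`). This file proves its CORE from a
lifting hypothesis that the three-copy Ihara lemma supplies (sibling `…LTwist.lean`):

* §A `q`-expansions: `cuspCoeff_degeneracyMap0` (`a_n(B_d g) = d^{k−1} a_{n/d}(g)` for
  `B_d = degeneracyMap0 M N d k = [diag(d,1)]_k`, the `Γ₀` twin of the tree's `cuspCoeff_degeneracyMap1`) and
  the DOUBLE TWIST identity `charTwist_charTwist_eq`: `(f_χ)_χ = B₁ f − (a_q/q)·B_q f + (1/q)·B_{q²} f` in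
  `S₂(Γ₀(N q²))` for `χ = (·/q)`, `q` an odd prime, and `f ∈ S₂(Γ₀(N))` with `a₀ = 0`, multiplicative
  coefficients and `a_{q^{e+2}} = a_q a_{q^{e+1}} − q a_{q^e}` (both sides have coefficients `𝟙_{q∤n} aₙ`;
  Shimura 1971 Prop. 3.64, Atkin–Li 1978 §3: `f_χ ⊗ χ = f − f∣U_q V_q`).
* §C `lTwist_core`: if `s₀ ∈ 𝕋_ℤ` (level `N`) acts on `f` by an integer `u` prime to `p` and every cycle
  `x ∈ H₁(X₀(N), ℤ)` lifts to `z ∈ H₁(X₀(Nq²), ℤ)` with `(α_*, β_*, γ_*) z = (s₀ x, 0, 0)` (`α, β, γ : τ ↦ τ, qτ,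
  q²τ`), then `z((f_χ)_χ) = u·x(f) ∈ Λ((f_χ)_χ)`, hence `τ(χ)·u·x(f) ∈ Λ(f_χ)` by Stevens (5.4) on `Γ₀` (tree
  `gaussSum_mul_mem_periodLattice_of_mem_charTwist`), `τ(χ)² = q*` (`gaussSum_jacobiChar_sq`), and Bezout on
  `(q* u, p) = 1` gives `x(f) ∈ s·Λ(f_χ) + p·Λ(f)` for any `s` with `s² = q*`.

References: [Stevens1989] Lemma (5.4) p. 97; [Shimura1971] Prop. 3.64; [AtkinLi1978] §3;
[DiamondShurman2005] §5.7 p. 211, (8.44); [CremonaAlgorithms1997] §2.1 (2.1.1), §2.4;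
[DarmonDiamondTaylor1995] §4.5 p. 137 (the lift).
-/

set_option autoImplicit false
-- the Theorems directory repeats the summit name (sibling precedent `SignedBaseChangeAssembly.lean`)
set_option linter.dupNamespace false

noncomputable section

open scoped MatrixGroups ModularForm NumberTheorySymbols

open CongruenceSubgroup UpperHalfPlane

namespace Summit.BirchSwinnertonDyer.BirchSwinnertonDyer.Theorems.LTwist

open Literature.NumberTheory.EllipticCurves.ModularForms Literature.NumberTheory.QuadraticFields

/-! ### §A.1 `q`-expansion of the degeneracy map `B_d = [diag(d,1)]₂` on `Γ₀` -/

/-- `1` is a strict period of `Γ₀(N)`. [folklore] -/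
theorem one_mem_strictPeriods_gamma0 (N : ℕ) :
    (1 : ℝ) ∈ ((Gamma0 N : Subgroup SL(2, ℤ)) : Subgroup (GL (Fin 2) ℝ)).strictPeriods :=
  strictWidthInfty_Gamma0 N ▸ Subgroup.strictWidthInfty_mem_strictPeriods _

/-- **`q`-expansion of the degeneracy map on `Γ₀`**: for `M d ∣ N` and `g ∈ S_k(Γ₀(M))`,
`a_n(B_d g) = d^{k-1} a_{n/d}(g)` if `d ∣ n` and `0` otherwise, where
`B_d = degeneracyMap0 M N d k = [diag(d,1)]_k` (`(B_d g)(τ) = d^{k-1} g(dτ)`; Diamond–Shurman §5.7,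
p. 211; the `Γ₁` twin is the tree's `cuspCoeff_degeneracyMap1`). [cite: DiamondShurman2005, §5.7 p. 211] -/
theorem cuspCoeff_degeneracyMap0 {M N d : ℕ} [NeZero M] [NeZero N] [NeZero d] {k : ℤ}
    (hMd : M * d ∣ N) (g : CuspForm (Gamma0 M) k) (n : ℕ) :
    cuspCoeff (degeneracyMap0 M N d k g) n =
      (d : ℂ) ^ (k - 1) * (if d ∣ n then cuspCoeff g (n / d) else 0) := by
  have hd : 0 < d := NeZero.pos d
  have hd0 : (d : ℂ) ≠ 0 := Nat.cast_ne_zero.mpr hd.ne'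
  set F := degeneracyMap0 M N d k g with hF_def
  have hFτ : ∀ τ : ℍ, F τ = (d : ℂ) ^ (k - 1) *
      g ⟨(d : ℂ) * τ, by simpa using mul_pos (Nat.cast_pos.mpr hd) τ.2⟩ := fun τ ↦ by
    have h1 := smul_slash_diagGL_apply k d hd ⇑g τ
    rw [← coe_degeneracyMap0_eq_slash M N d k hMd g, Pi.smul_apply, smul_eq_mul] at h1
    have h2 : ((⟨(d : ℝ), Nat.cast_pos.mpr hd⟩ : {x : ℝ // 0 < x}) • τ : ℍ) =
        ⟨(d : ℂ) * τ, by simpa using mul_pos (Nat.cast_pos.mpr hd) τ.2⟩ := by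
      apply UpperHalfPlane.ext
      simp [UpperHalfPlane.coe_pos_real_smul]
    rw [h2] at h1
    rw [← h1, ← mul_assoc, ← zpow_add₀ hd0, show k - 1 + (1 - k) = 0 by ring, zpow_zero, one_mul]
  symm
  refine ModularFormClass.qExpansion_coeff_unique one_pos (one_mem_strictPeriods_gamma0 N)
    (f := F) (c := fun m ↦ (d : ℂ) ^ (k - 1) * (if d ∣ m then cuspCoeff g (m / d) else 0))
    (fun τ ↦ ?_) n
  set τ' : ℍ := ⟨(d : ℂ) * τ, by simpa using mul_pos (Nat.cast_pos.mpr hd) τ.2⟩ with hτ'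
  have hg := hasSum_qExpansion_of_mem_strictPeriods one_pos (one_mem_strictPeriods_gamma0 M) g τ'
  have hq : Function.Periodic.qParam 1 (τ' : ℂ) = Function.Periodic.qParam 1 τ ^ d :=
    qParam_one_natMul d τ
  rw [hq] at hg
  rw [hFτ τ]
  have hg' := hg.mul_left ((d : ℂ) ^ (k - 1))
  refine ((mul_right_injective₀ hd.ne').hasSum_iff ?_).mp ?_
  · intro m hm
    have : ¬ d ∣ m := by
      rintro ⟨j, rfl⟩
      exact hm ⟨j, rfl⟩
    simp [this]
  · have hfun : ((fun m ↦ ((d : ℂ) ^ (k - 1) * (if d ∣ m then cuspCoeff g (m / d) else 0)) •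
        Function.Periodic.qParam 1 τ ^ m) ∘ fun x ↦ d * x) =
        fun i ↦ (d : ℂ) ^ (k - 1) *
          ((qExpansion 1 ⇑g).coeff i • (Function.Periodic.qParam 1 τ ^ d) ^ i) := by
      funext m
      simp only [Function.comp_apply, smul_eq_mul, cuspCoeff]
      rw [if_pos (dvd_mul_right d m), Nat.mul_div_cancel_left m hd, pow_mul, mul_assoc]
    rw [hfun]
    exact hg'

/-! ### §A.2 The double twist `(f_χ)_χ = f − (a_q/q)·B_q f + (1/q)·B_{q²} f` on `Γ₀(M q²)` -/

/-- `χ_q(n)² = 𝟙_{q ∤ n}` for the quadratic character `χ_q = (·/q)` of an odd prime `q`. [folklore] -/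
theorem jacobiChar_mul_self_natCast {q : ℕ} [NeZero q] [Fact q.Prime] (n : ℕ) :
    jacobiChar q n * jacobiChar q n = if q ∣ n then 0 else 1 := by
  rw [jacobiChar_natCast]
  by_cases hqn : q ∣ n
  · rw [if_pos hqn]
    have h0 : J((n : ℤ) | q) = 0 := by
      rw [jacobiSym.eq_zero_iff_not_coprime]
      intro h
      have : q ∣ Int.gcd (n : ℤ) q := by
        rw [Int.gcd_natCast_natCast]; exact Nat.dvd_gcd hqn dvd_rfl
      rw [h] at this
      exact (Fact.out : q.Prime).one_lt.ne' (Nat.dvd_one.mp this)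
    rw [h0]; push_cast; ring
  · rw [if_neg hqn]
    have hcop : Int.gcd (n : ℤ) q = 1 := by
      rw [Int.gcd_natCast_natCast]
      exact (Nat.coprime_comm.mp ((Nat.Prime.coprime_iff_not_dvd Fact.out).mpr hqn))
    have h1 : J((n : ℤ) | q) ^ 2 = 1 := jacobiSym.sq_one hcop
    have : (J((n : ℤ) | q) : ℂ) * J((n : ℤ) | q) = 1 := by
      rw [← sq]; exact_mod_cast h1
    exact this

/-- `aₙ(x + y) = aₙ(x) + aₙ(y)` on `S_k(Γ₀(N))`. [folklore] -/
theorem cuspCoeff_add_gamma0 {N : ℕ} {k : ℤ} (x y : CuspForm (Gamma0 N) k) (n : ℕ) :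
    cuspCoeff (x + y) n = cuspCoeff x n + cuspCoeff y n := by
  simp only [cuspCoeff]
  rw [CuspForm.coe_add, ModularForm.qExpansion_add one_pos (one_mem_strictPeriods_gamma0 N) x y, map_add]

/-- `aₙ(c • x) = c aₙ(x)` on `S_k(Γ₀(N))`. [folklore] -/
theorem cuspCoeff_smul_gamma0 {N : ℕ} {k : ℤ} (c : ℂ) (x : CuspForm (Gamma0 N) k) (n : ℕ) :
    cuspCoeff (c • x) n = c * cuspCoeff x n := by
  simp only [cuspCoeff]
  rw [CuspForm.IsGLPos.coe_smul, ModularForm.qExpansion_smul one_pos (one_mem_strictPeriods_gamma0 N) _ x,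
    map_smul, smul_eq_mul]

/-- `aₙ(x − y) = aₙ(x) − aₙ(y)` on `S_k(Γ₀(N))`. [folklore] -/
theorem cuspCoeff_sub_gamma0 {N : ℕ} {k : ℤ} (x y : CuspForm (Gamma0 N) k) (n : ℕ) :
    cuspCoeff (x - y) n = cuspCoeff x n - cuspCoeff y n := by
  simp only [cuspCoeff]
  rw [CuspForm.coe_sub, ModularForm.qExpansion_sub one_pos (one_mem_strictPeriods_gamma0 N) x y, map_sub]

/-- Linearity of `cuspCoeff` on `Γ₀(N)` for the shape `x − c • y + c' • z`. [folklore] -/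
theorem cuspCoeff_sub_smul_add_smul {N : ℕ} {k : ℤ} (x y z : CuspForm (Gamma0 N) k) (c c' : ℂ) (n : ℕ) :
    cuspCoeff (x - c • y + c' • z) n = cuspCoeff x n - c * cuspCoeff y n + c' * cuspCoeff z n := by
  rw [cuspCoeff_add_gamma0, cuspCoeff_sub_gamma0, cuspCoeff_smul_gamma0, cuspCoeff_smul_gamma0]

/-- **The double twist identity.** Let `q` be an odd prime, `χ = (·/q)`, `M ≥ 1`, `L = M q²`, and
`f ∈ S₂(Γ₀(M))` with `a₀ = 0`, MULTIPLICATIVE coefficients and the good-Euler-factor recursion at `q`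
(`a_{q^{e+2}} = a_q a_{q^{e+1}} − q a_{q^e}`; e.g. the newform of an elliptic curve of conductor `M`,
`q ∤ M`). Then, in `S₂(Γ₀(L))`, `(f_χ)_χ = B₁ f − (a_q/q)·B_q f + (1/q)·B_{q²} f` (`B_d = [diag(d,1)]₂`):
both sides have `n`-th coefficient `𝟙_{q∤n} aₙ` (`a_{qm} = a_q a_m`, `a_{q^{e+2}m} − a_q a_{q^{e+1}m} + q a_{q^e m} = 0`
for `q ∤ m`). This is `f_χ ⊗ χ = f − f∣U_q V_q` (Shimura 1971 Prop. 3.64; Atkin–Li 1978 §3).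
[cite: Shimura1971, Prop. 3.64] -/
theorem charTwist_charTwist_eq {M q : ℕ} [NeZero M] [NeZero q] [Fact q.Prime] (hq2 : q ≠ 2)
    (hχ : (jacobiChar q).IsQuadratic)
    (f : CuspForm (Gamma0 M) 2) (h0 : cuspCoeff f 0 = 0)
    (hmul : ∀ m n : ℕ, m.Coprime n → cuspCoeff f (m * n) = cuspCoeff f m * cuspCoeff f n)
    (hrec : ∀ e : ℕ, cuspCoeff f (q ^ (e + 2)) =
      cuspCoeff f q * cuspCoeff f (q ^ (e + 1)) - q * cuspCoeff f (q ^ e)) :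
    charTwist (M * q ^ 2) (dvd_refl _) (dvd_mul_left (q ^ 2) M) hχ
        (charTwist (M * q ^ 2) (dvd_mul_right M (q ^ 2)) (dvd_mul_left (q ^ 2) M) hχ f) =
      degeneracyMap0 M (M * q ^ 2) 1 2 f - (cuspCoeff f q / q) • degeneracyMap0 M (M * q ^ 2) q 2 f +
        (1 / q : ℂ) • degeneracyMap0 M (M * q ^ 2) (q ^ 2) 2 f := by
  have hqP : q.Prime := Fact.out
  have hq0 : (q : ℂ) ≠ 0 := Nat.cast_ne_zero.mpr hqP.ne_zero
  have hodd : Odd q := hqP.odd_of_ne_two hq2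
  have hprim : (jacobiChar q).IsPrimitive := isPrimitive_jacobiChar hodd hqP.squarefree
  refine eq_of_forall_cuspCoeff_eq_gamma0 fun n ↦ ?_
  rw [cuspCoeff_charTwist _ _ _ hχ hprim, cuspCoeff_charTwist _ _ _ hχ hprim, ← mul_assoc,
    jacobiChar_mul_self_natCast, cuspCoeff_sub_smul_add_smul,
    cuspCoeff_degeneracyMap0 (by simp) f n,
    cuspCoeff_degeneracyMap0 (show M * q ∣ M * q ^ 2 from
      mul_dvd_mul_left M (dvd_pow_self q two_ne_zero)) f n,
    cuspCoeff_degeneracyMap0 (dvd_refl _) f n]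
  simp only [Nat.cast_one, one_dvd, if_true, Nat.div_one, show (2 : ℤ) - 1 = 1 by norm_num, zpow_one,
    one_mul]
  rcases Nat.eq_zero_or_pos n with rfl | hn
  · simp [h0]
  obtain ⟨e, m, hm, rfl⟩ := Nat.exists_eq_pow_mul_and_not_dvd hn.ne' q hqP.one_lt.ne'
  have hcop : ∀ j : ℕ, (q ^ j).Coprime m :=
    fun j ↦ Nat.Coprime.pow_left j ((Nat.Prime.coprime_iff_not_dvd hqP).mpr hm)
  have hqpos : 0 < q := hqP.pos
  rcases e with _ | _ | e
  · -- `q ∤ n`: both sides are `aₙ`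
    have h2 : ¬ q ^ 2 ∣ m := fun h ↦ hm ((dvd_pow_self q two_ne_zero).trans h)
    simp only [pow_zero, one_mul]
    rw [if_neg hm, if_neg hm, if_neg h2]
    ring
  · -- `q ∥ n`: `0 = a_{qm} − a_q a_m`
    have h1 : q ∣ q ^ (0 + 1) * m := ⟨m, by ring⟩
    have h2 : ¬ q ^ 2 ∣ q ^ (0 + 1) * m := by
      rintro ⟨t, ht⟩
      apply hm
      refine ⟨t, Nat.eq_of_mul_eq_mul_left hqpos ?_⟩
      calc q * m = q ^ (0 + 1) * m := by ring
        _ = q ^ 2 * t := ht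
        _ = q * (q * t) := by ring
    rw [if_pos h1, if_pos h1, if_neg h2, show q ^ (0 + 1) * m / q = m by
      rw [zero_add, pow_one, Nat.mul_div_cancel_left m hqpos], show q ^ (0 + 1) * m = q * m by ring,
      hmul q m ((pow_one q) ▸ hcop 1)]
    field_simp
    ring
  · -- `q² ∣ n`: `0 = a_m (a_{q^{e+2}} − a_q a_{q^{e+1}} + q a_{q^e})`
    have h1 : q ∣ q ^ (e + 1 + 1) * m := ⟨q ^ (e + 1) * m, by ring⟩
    have h2 : q ^ 2 ∣ q ^ (e + 1 + 1) * m := ⟨q ^ e * m, by ring⟩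
    rw [if_pos h1, if_pos h1, if_pos h2,
      show q ^ (e + 1 + 1) * m / q = q ^ (e + 1) * m by
        rw [show q ^ (e + 1 + 1) * m = q * (q ^ (e + 1) * m) by ring, Nat.mul_div_cancel_left _ hqpos],
      show q ^ (e + 1 + 1) * m / q ^ 2 = q ^ e * m by
        rw [show q ^ (e + 1 + 1) * m = q ^ 2 * (q ^ e * m) by ring,
          Nat.mul_div_cancel_left _ (pow_pos hqpos 2)],
      show q ^ (e + 1 + 1) * m = q ^ (e + 2) * m by ring,
      hmul _ m (hcop (e + 2)), hmul _ m (hcop (e + 1)), hmul _ m (hcop e), hrec e]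
    push_cast
    field_simp
    ring

/-! ### §C Periods: cycles of level `M q²` read on `f − (a_q/q) B_q f + (1/q) B_{q²} f`, and the core lemma -/

/-- A cycle `z ∈ H₁(X₀(L), ℤ)` evaluated on any `h ∈ S₂(Γ₀(L))` is a period of `h`: `z(h) ∈ Λ(h)`
(generators `{∞, γ∞}_h`). [cite: CremonaAlgorithms1997, §2.1 (2.1.1)] -/
theorem apply_mem_periodLattice_of_mem_periodHomology {L : ℕ} [NeZero L]
    {z : Module.Dual ℂ (CuspForm (Gamma0 L) 2)} (hz : z ∈ periodHomology L) (h : CuspForm (Gamma0 L) 2) :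
    z h ∈ periodLattice h := by
  rw [periodLattice_eq_map_periodHomology]
  exact ⟨z, hz, rfl⟩

/-- Every period of `f` is `x(f)` for a cycle `x ∈ H₁(X₀(M), ℤ)`. [cite: CremonaAlgorithms1997, §2.1 (2.1.1)] -/
theorem exists_mem_periodHomology_apply_eq {M : ℕ} [NeZero M] (f : CuspForm (Gamma0 M) 2) {z : ℂ}
    (hz : z ∈ periodLattice f) : ∃ x ∈ periodHomology M, x f = z := by
  rw [periodLattice_eq_map_periodHomology] at hz
  obtain ⟨x, hx, rfl⟩ := hz
  exact ⟨x, hx, rfl⟩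

/-- `τ(χ_q)² = q* = (−1)^{(q−1)/2} q` for the quadratic character of an odd prime `q`
(Mathlib `gaussSum_sq`, `χ_q(−1) = χ₄(q)`). [folklore] -/
theorem gaussSum_jacobiChar_sq {q : ℕ} [NeZero q] [Fact q.Prime] (hq2 : q ≠ 2) :
    gaussSum (jacobiChar q) (ZMod.stdAddChar (N := q)) ^ 2 = (((-1 : ℤ) ^ (q / 2) * q : ℤ) : ℂ) := by
  have hqP : q.Prime := Fact.out
  have hodd : Odd q := hqP.odd_of_ne_two hq2
  have hprim : (jacobiChar q).IsPrimitive := isPrimitive_jacobiChar hodd hqP.squarefree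
  have hne : jacobiChar q ≠ 1 := by
    intro h
    have h1 : (jacobiChar q).conductor = 1 := by rw [h, DirichletCharacter.conductor_one]
    rw [(DirichletCharacter.isPrimitive_def _).mp hprim] at h1
    exact hqP.one_lt.ne' h1
  rw [gaussSum_sq hne (fun a ↦ jacobiChar_trichotomy a) (ZMod.isPrimitive_stdAddChar q), ZMod.card]
  have hm1 : jacobiChar q (-1) = (J((-1 : ℤ) | q) : ℂ) := by
    have := jacobiChar_intCast (q := q) (-1)
    push_cast at this ⊢
    exact this
  rw [hm1, jacobiSym.at_neg_one hodd, ZMod.χ₄_eq_neg_one_pow (Nat.odd_iff.mp hodd)]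
  push_cast
  ring

/-- **The core of L-TWIST.** Let `q` be an odd prime, `χ = (·/q)`, `f ∈ S₂(Γ₀(M))` with `a₀ = 0`,
multiplicative coefficients and the good Euler recursion at `q` (e.g. the newform of an elliptic curve of
conductor `M`, `q ∤ M`), `L = M q²`, `f_χ ∈ S₂(Γ₀(L))` its twist; let `p` be a prime, `p ≠ q`, and `s₀ ∈ 𝕋_ℤ`
(level `M`) acting on `f` by an integer `u` prime to `p` such that every cycle `x ∈ H₁(X₀(M), ℤ)` lifts to
`z ∈ H₁(X₀(L), ℤ)` with `α_* z = s₀ x`, `β_* z = 0`, `γ_* z = 0` (`α, β, γ : τ ↦ τ, qτ, q²τ` — Ihara's lemma in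
the three-copy form, localised at a non-Eisenstein maximal ideal avoiding `s₀`). Then
**`Λ(f) ⊆ τ(χ)·Λ(f_χ) + p·Λ(f)`**: for `z = x(f)`, `z' := lift`, `z'((f_χ)_χ) = z'(B₁f) − (a_q/q) z'(B_q f)
+ (1/q) z'(B_{q²} f) = u·z` lies in `Λ((f_χ)_χ)`, so `τ u z ∈ Λ(f_χ)` (Stevens (5.4) on `Γ₀`, tree
`gaussSum_mul_mem_periodLattice_of_mem_charTwist`), `τ² = q*`, and Bezout on `(q* u, p) = 1`.
[cite: Stevens1989, Lemma (5.4) p. 97] [cite: DarmonDiamondTaylor1995, §4.5 p. 137] -/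
theorem lTwist_core {M q p : ℕ} [NeZero M] [NeZero q] [Fact q.Prime] [Fact p.Prime] (hq2 : q ≠ 2)
    (hqp : q ≠ p) (hχ : (jacobiChar q).IsQuadratic)
    (f : CuspForm (Gamma0 M) 2) (h0 : cuspCoeff f 0 = 0)
    (hmul : ∀ m n : ℕ, m.Coprime n → cuspCoeff f (m * n) = cuspCoeff f m * cuspCoeff f n)
    (hrec : ∀ e : ℕ, cuspCoeff f (q ^ (e + 2)) =
      cuspCoeff f q * cuspCoeff f (q ^ (e + 1)) - q * cuspCoeff f (q ^ e))
    (s₀ : HeckeRing0 M 2) (u : ℤ) (hu : ¬ (p : ℤ) ∣ u) (hs₀ : HeckeRing0.toEnd M 2 s₀ f = (u : ℂ) • f)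
    (hlift : ∀ x ∈ periodHomology M, ∃ z ∈ periodHomology (M * q ^ 2),
      (degeneracyMap0 M (M * q ^ 2) 1 2).dualMap z = s₀ • x ∧
      (degeneracyMap0 M (M * q ^ 2) q 2).dualMap z = 0 ∧
      (degeneracyMap0 M (M * q ^ 2) (q ^ 2) 2).dualMap z = 0)
    (s : ℂ) (hs2 : s ^ 2 = (((-1 : ℤ) ^ (q / 2) * q : ℤ) : ℂ)) :
    ∀ z ∈ periodLattice f,
      ∃ w ∈ periodLattice (charTwist (M * q ^ 2) (dvd_mul_right M (q ^ 2)) (dvd_mul_left (q ^ 2) M) hχ f),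
        ∃ y ∈ periodLattice f, z = s * w + (p : ℂ) * y := by
  intro z hz
  have hqP : q.Prime := Fact.out
  have hpP : p.Prime := Fact.out
  have hodd : Odd q := hqP.odd_of_ne_two hq2
  have hprim : (jacobiChar q).IsPrimitive := isPrimitive_jacobiChar hodd hqP.squarefree
  set fχ := charTwist (M * q ^ 2) (dvd_mul_right M (q ^ 2)) (dvd_mul_left (q ^ 2) M) hχ f with hfχ
  set τ : ℂ := gaussSum (jacobiChar q) (ZMod.stdAddChar (N := q)) with hτ
  set d : ℤ := (-1 : ℤ) ^ (q / 2) * q with hd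
  -- the cycle `x` carrying `z` and its lift `z'`
  obtain ⟨x, hx, rfl⟩ := exists_mem_periodHomology_apply_eq f hz
  obtain ⟨z', hz', hα, hβ, hγ⟩ := hlift x hx
  -- `z'((f_χ)_χ) = u · x(f)`
  have hdouble := charTwist_charTwist_eq (M := M) hq2 hχ f h0 hmul hrec
  have heval : z' (charTwist (M * q ^ 2) (dvd_refl _) (dvd_mul_left (q ^ 2) M) hχ fχ) = (u : ℂ) * x f := by
    rw [hfχ, hdouble, map_add, map_sub, map_smul, map_smul, smul_eq_mul, smul_eq_mul,
      ← LinearMap.dualMap_apply, ← LinearMap.dualMap_apply, ← LinearMap.dualMap_apply, hα, hβ, hγ,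
      LinearMap.zero_apply, mul_zero, sub_zero, mul_zero, add_zero,
      HeckeRing0.smul_dual_apply, hs₀, map_smul, smul_eq_mul]
  -- `u · z ∈ Λ((f_χ)_χ)`, hence `τ u z ∈ Λ(f_χ)`
  have hmem : (u : ℂ) * x f ∈
      periodLattice (charTwist (M * q ^ 2) (dvd_refl _) (dvd_mul_left (q ^ 2) M) hχ fχ) := by
    rw [← heval]; exact apply_mem_periodLattice_of_mem_periodHomology hz' _
  have hmemτ : τ * ((u : ℂ) * x f) ∈ periodLattice fχ :=
    gaussSum_mul_mem_periodLattice_of_mem_charTwist (M * q ^ 2) (dvd_refl _) (dvd_mul_left (q ^ 2) M) hχ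
      hprim fχ hmem
  -- Bezout on `(d u, p) = 1`
  have hτ2 : τ ^ 2 = (d : ℂ) := by rw [hτ, gaussSum_jacobiChar_sq hq2, hd]
  have hcop : IsCoprime (d * u) (p : ℤ) := by
    have hpZ : Prime (p : ℤ) := Nat.prime_iff_prime_int.mp hpP
    refine (Prime.coprime_iff_not_dvd hpZ).mpr ?_ |>.symm
    intro hdiv
    rcases hpZ.dvd_or_dvd hdiv with h1 | h1
    · rw [hd] at h1
      rcases hpZ.dvd_or_dvd h1 with h2 | h2
      · have := Int.natAbs_dvd_natAbs.mpr (hpZ.dvd_of_dvd_pow h2)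
        simp only [Int.natAbs_neg, Int.natAbs_one, Nat.dvd_one, Int.natAbs_natCast] at this
        exact hpP.one_lt.ne' this
      · exact hqp ((Nat.prime_dvd_prime_iff_eq hpP hqP).mp (Int.natCast_dvd_natCast.mp h2)).symm
    · exact hu h1
  obtain ⟨α, β, hαβ⟩ := hcop
  -- `z = τ (α τ u z) + p (β z)`; `τ = ± s`
  have hτs : τ = s ∨ τ = -s := by
    have : τ ^ 2 = s ^ 2 := by rw [hτ2, hs2, hd]
    exact sq_eq_sq_iff_eq_or_eq_neg.mp this |>.imp id id
  have key : x f = τ * ((α : ℂ) * (τ * ((u : ℂ) * x f))) + (p : ℂ) * ((β : ℂ) * x f) := by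
    have e1 : ((α * (d * u) + β * p : ℤ) : ℂ) = 1 := by rw [hαβ]; push_cast; ring
    calc x f = ((α * (d * u) + β * p : ℤ) : ℂ) * x f := by rw [e1, one_mul]
      _ = τ * ((α : ℂ) * (τ * ((u : ℂ) * x f))) + (p : ℂ) * ((β : ℂ) * x f) := by
        push_cast; rw [← hτ2]; ring
  rcases hτs with hτs | hτs
  · refine ⟨(α : ℂ) * (τ * ((u : ℂ) * x f)), ?_, (β : ℂ) * x f, ?_, ?_⟩
    · simpa only [zsmul_eq_mul] using (periodLattice fχ).zsmul_mem hmemτ α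
    · simpa only [zsmul_eq_mul] using (periodLattice f).zsmul_mem hz β
    · rw [← hτs]; exact key
  · refine ⟨-((α : ℂ) * (τ * ((u : ℂ) * x f))), ?_, (β : ℂ) * x f, ?_, ?_⟩
    · exact neg_mem (by simpa only [zsmul_eq_mul] using (periodLattice fχ).zsmul_mem hmemτ α)
    · simpa only [zsmul_eq_mul] using (periodLattice f).zsmul_mem hz β
    · rw [mul_neg, ← neg_mul, ← hτs]; exact key

end Summit.BirchSwinnertonDyer.BirchSwinnertonDyer.Theorems.LTwist

end
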